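import Summits.QuantumFields.BalabanUV.T4Continuum.Support.NE3CovariantLineSumGauge
import HarnessLib

/-!
# T⁴ programme, node NE3 — route H♮ row K4, item K4-d1 «THE CORE AT W», file 2∕2: the LOCAL block-Poincaré core at a unitary
# small-field background (covariant gradients, the corner-read comb line sum explicit) and its torus sums
# `Σ‖η‖²_HS ≤ 10·M²·CG + 8·(M²M^d)⁻¹·Σ‖TWc‖²_HS + (80d + 448)·d²·(M²a)²·Σ‖η‖²_HS`

NE3 formalisation swarm `b2b-balaban-t4-ne3-formalise-*`, LEAF PROVER 03 (unit `b2b-balaban-t4-ne3-formalise-leaf-03`, gen 8; cell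
`pub-balaban`); row **K4** (ruling ρ-g22-2 l.17514, SHAPE K4 l.17848), item **K4-d1** «THE CORE AT W» (INTENT ∕ CLAIM journal l.18665,
owner GO + split ruling ρ-g23-2 l.18808: K4-d2 «THE S-BOUND AT W» = owner g23, `NE3CovariantSBound`); file 1 = `NE3CovariantLineSumGauge`
(HS bookkeeping, gauge covariance of `TWc`, the comb transports in row C0's `κ`-first comb gauge).

WHAT (all [folklore]; 0 sorry; 0 `def`).  For a unitary `W` with `SmallField W a` (`0 ≤ a`), `M ≥ 1`, EVERY direction field `η`, block
`z`, component `κ`, `q = M•z`, `α = d·M·a`: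
§4 **`sum_block_nhsNormSq_le_covariant`** — LOCAL (no torus, no `N`, no tangency, no Landau condition):
   `M²·M^d·Σ_{v∈B}‖η(q+v,κ)‖²_HS ≤ M²M^d·M²·Σ_vΣ_μ[2‖covFd W η (q+v) μ κ‖²_HS + 64α²‖η(q+v+e_μ,κ)‖²_HS + 16α²‖η(q+v,κ)‖²_HS]
    + 4·M²M^dM·Σ_vΣ_{j<M}[2‖covFd W η (q+v+je_κ) κ κ‖²_HS + 64α²‖η(q+v+(j+1)e_κ,κ)‖²_HS + 16α²‖η(q+v+je_κ,κ)‖²_HS]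
    + 8·‖TWg M (combFrame W M) η z κ‖²_HS + 128·M^dM³·α²·Σ_vΣ_{i<M}‖η(q+v+ie_κ,κ)‖²_HS`
   = file 1's HS flat core applied to the gauge-fixed field `η^u` in the `κ`-first comb gauge `u = lcomb κ M W z`: (i) `‖η^u‖_HS = ‖η‖_HS`
   pointwise; (ii) the OSC∕SEG flat differences of `η^u` against `covFd W η` (file 1 §2 + row C0's bond bounds, §3); (iii) the flat line
   sum of `η^u` = `TWg M (combFrame W^u M) η^u − Σ_copies (Ad (combTransport W^u … (i+1)) − 1) η^u`, the first with the HS norm of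
   `TWg M (combFrame W M) η` (gauge covariance), each defect `≤ 4(2Mα)²‖η‖²_HS`, Cauchy–Schwarz over the `M^d·M` copies;
§5 **`sum_nhsNormSq_le_covariant_torus`** (`W`, `η` `(M·N)`-periodic, `N ≥ 1`; re-tiling by `sum_blocks_torus(_shift)`, `sum_periodBox_shift`):
   `M²M^d·E ≤ M^dM⁴·(10·CG + (80d + 448)·(dMa)²·E) + 8·TT`, `E = Σ_xΣ_κ‖η x κ‖²_HS`, `CG = Σ_xΣ_μΣ_ν‖covFd W η x μ ν‖²_HS` over
   `periodBox (M·N)`, `TT = Σ_{z∈periodBox N}Σ_κ‖TWg M (combFrame W M) η z κ‖²_HS`; the Θ-FREE TWO-TERM FORM (ρ-g23-2: K6 substitutes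
   K4-d2's S-identity for `TT`) **`sum_nhsNormSq_le_covariant_torus'`** ∕ **`…_torus_TWc`** (K4-a's `TWc L k W η` BY NAME, `M = L^k`):
   `E ≤ 10·M²·CG + 8·(M²M^d)⁻¹·TT + (80d + 448)·d²·(M²a)²·E`; and the Θ-FORM of SHAPE K4 **`sum_nhsNormSq_le_of_TWg_sq_le`**:
   `TT ≤ Θ·M^dM⁴·CG ⇒ E ≤ (10 + 8Θ)·M²·CG + (80d + 448)·d²·(M²a)²·E`.
CONSTANT TARGET of SHAPE K4 met: the only remainder is `(M²a)² ×` the natural ℓ² size (no bare `M^{1∕2}`, no operator norm, no `card n`);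
the HS-vs-flat factor 2 of the gradient bridge turns (71S)'s `5 + 4Θ` into `10 + 8Θ`.  NOT here: THE S-BOUND AT W (K4-d2), (P♮)_W, (ML_w).

HONEST FRAMING.  A theorem about OUR typed objects at ONE configuration (row C0's comb bounds quoted BY NAME); nothing about Bałaban's
minimisers; (P♮)_W, (ML_w) at W ≠ 1, T-E_w and NE3 are NOT proved; spine PROVED 0∕9; finite T⁴ rung (B)+1 — NOT infinite volume, NOT
mass gap, NOT BetaPertH, NOT Clay.  ABSOLUTE RULE kept (nothing printed is a hypothesis; context only: [Balaban1985Averaging] pp. 24–25,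
[Balaban1985PropagatorsII] Thm 3.3 (3.46)).  PLACEMENT: `Summits/QuantumFields/BalabanUV/`; imports file 1 only.  HONEST DEPENDENCY (cell
page 1): continuum YM on T⁴ ⇐ BetaPertH ∧ nine spine estimates (0/9 proved); BetaPertH ⇐ (D1) ∧ (D4) ∧ CAP+tail; G-an2-4 gates asym, D1
and NE2/3/4.
-/

set_option autoImplicit false

open scoped BigOperators Matrix Matrix.Norms.L2Operator
open NormedSpace Finset

namespace Summit.QuantumFields.BalabanUV.T4Continuum.NE3CovariantLineSumCore

open Literature.MathematicalPhysics.QuantumFieldTheory.Balaban1983to89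
open B7Prop1Explicit B7Prop2Explicit MatrixLog UnitaryModel MatrixNorms
open T4AveragingDeficitWall (IsUnitaryCfg SmallField Ad)
open T4AveragingDeficitWallBoundary (periodBox mem_periodBox card_periodBox sum_periodBox_shift IsPeriodicCfg)
open T4AveragingDeficitNonAbelian (Ad_mul Ad_sub)
open AveragingDeficitNearIdentity (Ad_one Ad_sum norm_Ad_sub_le)
open AveragingDeficitLocality (dirGauge)
open AveragingDeficitCovGrad (covFd covFd_gaugeAct)
open AveragingDeficitHSInner (nhsNormSq_Ad nhsNorm_Ad_sub_le)
open NE3CovariantCalculus (nhsNormSq_sub_le nhsNormSq_neg)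
open NE3CombGaugeLine (lineWord lcomb lcomb_corner lcomb_mem norm_lcombGauge_sub_one_le norm_lcombGauge_sub_one_le_self
  l1_transverse_le isUnitaryCfg_lcombGauge transverse_apply_self transverse_apply_ne)
open NE3CovariantLineAdjoint (TWg klastWord disp_klastWord combTransport combFrame Ad_combFrame_inv TWc)
open NE3BlockPoincareCore (sum_rotate3 sum_rotate4 sum_blocks_torus sum_blocks_torus_shift)
open NE3CovariantBlockPoincare (nhsNormSq_Ad_sub_le)

noncomputable section

variable {d : ℕ} {n : Type*} [Fintype n] [DecidableEq n] [Nonempty n]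

/-! ## §4 THE CORE AT W — one block, one component, every direction field -/

/-- **THE CORE AT W, LOCAL FORM** (K4-d1; the curved twin of `NE3BlockPoincareLocal.sum_block_norm_sq_le` — statement in the header, §4):
one block, one component, EVERY `η`, unitary `W` with `SmallField W a`, `0 ≤ a`, `M ≥ 1`; `α = d·M·a`; the corner-read comb line sum
`TWg M (combFrame W M) η z κ` (= `TWc L k W η z κ` at `M = L^k`) kept explicit; every remainder `(M·α)² = d²(M²a)² ×` the natural ℓ² size.
[folklore] -/
theorem sum_block_nhsNormSq_le_covariant {M : ℕ} (hM : 1 ≤ M) {W : Site d → Fin d → (Matrix n n ℂ)ˣ} (hW : IsUnitaryCfg W)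
    {a : ℝ} (ha : 0 ≤ a) (hWa : SmallField W a) (η : Site d → Fin d → Matrix n n ℂ) (z : Site d) (κ : Fin d) :
    (M : ℝ) ^ 2 * (M : ℝ) ^ d * ∑ v ∈ periodBox (d := d) M, nhsNormSq (η ((M : ℤ) • z + v) κ)
      ≤ (M : ℝ) ^ 2 * (M : ℝ) ^ d * ((M : ℝ) ^ 2 * ∑ v ∈ periodBox (d := d) M, ∑ μ : Fin d,
            (2 * nhsNormSq (covFd W η ((M : ℤ) • z + v) μ κ)
              + 64 * ((d : ℝ) * M * a) ^ 2 * nhsNormSq (η ((M : ℤ) • z + v + e μ) κ)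
              + 16 * ((d : ℝ) * M * a) ^ 2 * nhsNormSq (η ((M : ℤ) • z + v) κ)))
        + 4 * ((M : ℝ) ^ 2 * ((M : ℝ) ^ d * M) * ∑ v ∈ periodBox (d := d) M, ∑ j ∈ range M,
            (2 * nhsNormSq (covFd W η ((M : ℤ) • z + v + (j : ℤ) • e κ) κ κ)
              + 64 * ((d : ℝ) * M * a) ^ 2 * nhsNormSq (η ((M : ℤ) • z + v + ((j : ℤ) + 1) • e κ) κ)
              + 16 * ((d : ℝ) * M * a) ^ 2 * nhsNormSq (η ((M : ℤ) • z + v + (j : ℤ) • e κ) κ)))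
        + 8 * nhsNormSq (TWg M (combFrame W M) η z κ)
        + 128 * ((M : ℝ) ^ d * (M : ℝ) ^ 3) * ((d : ℝ) * M * a) ^ 2
            * ∑ v ∈ periodBox (d := d) M, ∑ i ∈ range M, nhsNormSq (η ((M : ℤ) • z + v + (i : ℤ) • e κ) κ) := by
  have hd : (1 : ℝ) ≤ d := by exact_mod_cast Nat.one_le_of_lt (Fin.pos κ)
  have hM1 : (1 : ℝ) ≤ M := by exact_mod_cast hM
  have hM0 : (0 : ℝ) < M := by linarith
  set B : Finset (Site d) := periodBox (d := d) M with hB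
  set q : Site d := (M : ℤ) • z with hq
  set α : ℝ := (d : ℝ) * M * a with hα
  set c : ℝ := ((d : ℝ) - 1) * ((M : ℝ) - 1) * a with hc
  have hc0 : 0 ≤ c := mul_nonneg (mul_nonneg (by linarith) (by linarith)) ha
  have hcα : c ≤ α := by
    rw [hc, hα]
    have : ((d : ℝ) - 1) * ((M : ℝ) - 1) ≤ (d : ℝ) * M := by nlinarith
    exact mul_le_mul_of_nonneg_right this ha
  have hfarα : ((d : ℝ) - 1) * M * a ≤ α := by
    rw [hα]; exact mul_le_mul_of_nonneg_right (by nlinarith) ha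
  have hα0 : 0 ≤ α := hc0.trans hcα
  -- the gauge
  have hu : ∀ y, lcomb κ M W z y ∈ unitaryUnits (Matrix n n ℂ) := fun y => lcomb_mem hW κ M z y
  have hWu : IsUnitaryCfg (gaugeAct (lcomb κ M W z) W) := isUnitaryCfg_lcombGauge (M := M) hW κ z
  -- bond bounds in the gauge
  have hB1 : ∀ v ∈ B, ∀ μ : Fin d,
      ‖((gaugeAct (lcomb κ M W z) W (q + v) μ : (Matrix n n ℂ)ˣ) : Matrix n n ℂ) - 1‖ ≤ α := by
    intro v hv μ
    have hv' := (mem_periodBox (d := d)).mp hv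
    have hx : (M : ℤ) • z ≤ q + v := by
      intro j; have := (hv' j).1; simp only [hq, Pi.add_apply]; linarith
    have hxt : ∀ j, j ≠ κ → (q + v - (M : ℤ) • z) j ≤ (M : ℤ) - 1 := by
      intro j _; have := (hv' j).2; simp only [hq, Pi.sub_apply, Pi.add_apply]; omega
    exact (norm_lcombGauge_sub_one_le hW hWa hM ha κ z hx hxt μ).trans hcα
  have hB3 : ∀ v ∈ B, ∀ j : ℕ,
      ‖((gaugeAct (lcomb κ M W z) W (q + v + (j : ℤ) • e κ) κ : (Matrix n n ℂ)ˣ) : Matrix n n ℂ) - 1‖ ≤ α := by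
    intro v hv j
    have hv' := (mem_periodBox (d := d)).mp hv
    have hx : (M : ℤ) • z ≤ q + v + (j : ℤ) • e κ := by
      intro i; have := (hv' i).1
      simp only [hq, Pi.add_apply, Pi.smul_apply, e_apply, smul_eq_mul]
      split_ifs <;> nlinarith
    have hxt : ∀ i, i ≠ κ → (q + v + (j : ℤ) • e κ - (M : ℤ) • z) i ≤ (M : ℤ) - 1 := by
      intro i hi; have := (hv' i).2
      simp only [hq, Pi.sub_apply, Pi.add_apply, Pi.smul_apply, e_apply, if_neg hi, smul_eq_mul, mul_zero, add_zero]
      omega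
    exact (norm_lcombGauge_sub_one_le hW hWa hM ha κ z hx hxt κ).trans hcα
  have hB2 : ∀ v ∈ B, ∀ μ : Fin d,
      ‖((gaugeAct (lcomb κ M W z) W (q + v + e μ) κ : (Matrix n n ℂ)ˣ) : Matrix n n ℂ) - 1‖ ≤ α :=
    fun v hv μ => (norm_lcombGauge_far_sub_one_le hW hWa hM ha κ z hv μ).trans hfarα
  -- (OSC) and (SEG): the flat differences of the gauge-fixed field against the covariant ones of `η`
  have hOsc : ∀ v ∈ B, ∀ μ : Fin d,
      nhsNormSq (dirGauge (lcomb κ M W z) η (q + v + e μ) κ - dirGauge (lcomb κ M W z) η (q + v) κ)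
        ≤ 2 * nhsNormSq (covFd W η (q + v) μ κ) + 64 * α ^ 2 * nhsNormSq (η (q + v + e μ) κ)
          + 16 * α ^ 2 * nhsNormSq (η (q + v) κ) :=
    fun v hv μ => nhsNormSq_fd_dirGauge_le_hs hW hu η (q + v) μ κ (hB1 v hv μ) (hB2 v hv μ) (hB1 v hv κ)
  have hSeg : ∀ v ∈ B, ∀ j ∈ range M,
      nhsNormSq (dirGauge (lcomb κ M W z) η (q + v + ((j : ℤ) + 1) • e κ) κ - dirGauge (lcomb κ M W z) η (q + v + (j : ℤ) • e κ) κ)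
        ≤ 2 * nhsNormSq (covFd W η (q + v + (j : ℤ) • e κ) κ κ) + 64 * α ^ 2 * nhsNormSq (η (q + v + ((j : ℤ) + 1) • e κ) κ)
          + 16 * α ^ 2 * nhsNormSq (η (q + v + (j : ℤ) • e κ) κ) := by
    intro v hv j _
    have hstep : q + v + (j : ℤ) • e κ + e κ = q + v + ((j : ℤ) + 1) • e κ := by rw [add_smul, one_smul, add_assoc]
    have h2 : ‖((gaugeAct (lcomb κ M W z) W (q + v + (j : ℤ) • e κ + e κ) κ : (Matrix n n ℂ)ˣ) : Matrix n n ℂ) - 1‖ ≤ α := by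
      have := hB3 v hv (j + 1)
      rwa [show ((j + 1 : ℕ) : ℤ) • e κ = (j : ℤ) • e κ + e κ by push_cast; rw [add_smul, one_smul], ← add_assoc] at this
    have h := nhsNormSq_fd_dirGauge_le_hs hW hu η (q + v + (j : ℤ) • e κ) κ κ (hB3 v hv j) h2 (hB3 v hv j)
    rwa [hstep] at h
  -- (T): the flat line sum of the gauge-fixed field against the covariant comb line sum of record
  have hcopy : ∀ v ∈ B, ∀ i ∈ range M,
      nhsNormSq (Ad (combTransport (gaugeAct (lcomb κ M W z) W) M z κ v (i + 1)) (dirGauge (lcomb κ M W z) η (q + v + (i : ℤ) • e κ) κ)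
          - dirGauge (lcomb κ M W z) η (q + v + (i : ℤ) • e κ) κ)
        ≤ 16 * (M : ℝ) ^ 2 * α ^ 2 * nhsNormSq (η (q + v + (i : ℤ) • e κ) κ) := by
    intro v hv i hi
    have hT := norm_combTransport_lcombGauge_sub_one_le hW hWa hM ha κ z hv (mem_range.mp hi)
    have hT' : ‖((combTransport (gaugeAct (lcomb κ M W z) W) M z κ v (i + 1) : (Matrix n n ℂ)ˣ) : Matrix n n ℂ) - 1‖
        ≤ 2 * M * α := hT.trans (mul_le_mul_of_nonneg_left hcα (by positivity))
    have h := nhsNormSq_Ad_sub_le (NE3CovariantLineAdjoint.combTransport_mem hWu M z κ v (i + 1))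
      (dirGauge (lcomb κ M W z) η (q + v + (i : ℤ) • e κ) κ)
    have hn0 := nhsNormSq_nonneg (dirGauge (lcomb κ M W z) η (q + v + (i : ℤ) • e κ) κ)
    have hsq : ‖((combTransport (gaugeAct (lcomb κ M W z) W) M z κ v (i + 1) : (Matrix n n ℂ)ˣ) : Matrix n n ℂ) - 1‖ ^ 2
        ≤ (2 * M * α) ^ 2 := pow_le_pow_left₀ (norm_nonneg _) hT' 2
    have hnorm : nhsNormSq (dirGauge (lcomb κ M W z) η (q + v + (i : ℤ) • e κ) κ) = nhsNormSq (η (q + v + (i : ℤ) • e κ) κ) := by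
      simp only [dirGauge, nhsNormSq_Ad (hu _)]
    rw [← hnorm]
    nlinarith [h, hsq, hn0]
  have hTsum : nhsNormSq (∑ v ∈ B, ∑ i ∈ range M, dirGauge (lcomb κ M W z) η (q + v + (i : ℤ) • e κ) κ)
      ≤ 2 * nhsNormSq (TWg M (combFrame W M) η z κ)
        + 32 * ((M : ℝ) ^ d * (M : ℝ) ^ 3) * α ^ 2 * ∑ v ∈ B, ∑ i ∈ range M, nhsNormSq (η (q + v + (i : ℤ) • e κ) κ) := by
    set E : Matrix n n ℂ := ∑ v ∈ B, ∑ i ∈ range M,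
      (Ad (combTransport (gaugeAct (lcomb κ M W z) W) M z κ v (i + 1)) (dirGauge (lcomb κ M W z) η (q + v + (i : ℤ) • e κ) κ)
        - dirGauge (lcomb κ M W z) η (q + v + (i : ℤ) • e κ) κ) with hE
    have hsplit : ∑ v ∈ B, ∑ i ∈ range M, dirGauge (lcomb κ M W z) η (q + v + (i : ℤ) • e κ) κ
        = TWg M (combFrame (gaugeAct (lcomb κ M W z) W) M) (dirGauge (lcomb κ M W z) η) z κ - E := by
      rw [hE, TWg]
      simp only [Ad_combFrame_inv]
      rw [← hB, ← hq, ← Finset.sum_sub_distrib]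
      refine Finset.sum_congr rfl fun v _ => ?_
      rw [← Finset.sum_sub_distrib]
      refine Finset.sum_congr rfl fun i _ => ?_
      rw [sub_sub_cancel]
    have hEb : nhsNormSq E ≤ 16 * ((M : ℝ) ^ d * (M : ℝ) ^ 3) * α ^ 2 * ∑ v ∈ B, ∑ i ∈ range M, nhsNormSq (η (q + v + (i : ℤ) • e κ) κ) := by
      have h1 := nhsNormSq_sum_le_card_mul B (fun v => ∑ i ∈ range M,
        (Ad (combTransport (gaugeAct (lcomb κ M W z) W) M z κ v (i + 1)) (dirGauge (lcomb κ M W z) η (q + v + (i : ℤ) • e κ) κ)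
          - dirGauge (lcomb κ M W z) η (q + v + (i : ℤ) • e κ) κ))
      have h2 : ∀ v ∈ B, nhsNormSq (∑ i ∈ range M,
          (Ad (combTransport (gaugeAct (lcomb κ M W z) W) M z κ v (i + 1)) (dirGauge (lcomb κ M W z) η (q + v + (i : ℤ) • e κ) κ)
            - dirGauge (lcomb κ M W z) η (q + v + (i : ℤ) • e κ) κ))
          ≤ M * ∑ i ∈ range M, 16 * (M : ℝ) ^ 2 * α ^ 2 * nhsNormSq (η (q + v + (i : ℤ) • e κ) κ) := by
        intro v hv
        refine (nhsNormSq_sum_le_card_mul (range M) _).trans ?_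
        rw [card_range]
        exact mul_le_mul_of_nonneg_left (Finset.sum_le_sum fun i hi => hcopy v hv i hi) (Nat.cast_nonneg M)
      have h3 := Finset.sum_le_sum h2
      have hcardB : (B.card : ℝ) = (M : ℝ) ^ d := by rw [hB, card_periodBox]; push_cast; ring
      rw [hcardB] at h1
      rw [hE]
      refine h1.trans ?_
      refine (mul_le_mul_of_nonneg_left h3 (by positivity)).trans (le_of_eq ?_)
      simp only [← Finset.mul_sum]
      ring
    rw [hsplit]
    have h4 := nhsNormSq_sub_le (TWg M (combFrame (gaugeAct (lcomb κ M W z) W) M) (dirGauge (lcomb κ M W z) η) z κ) E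
    rw [nhsNormSq_TWg_combFrame_gaugeAct hu] at h4
    linarith [h4, hEb]
  -- the flat core for the gauge-fixed field, and the assembly
  have hcore := sum_block_nhsNormSq_le hM (dirGauge (lcomb κ M W z) η) z κ
  have hLHS : ∑ v ∈ B, nhsNormSq (dirGauge (lcomb κ M W z) η (q + v) κ) = ∑ v ∈ B, nhsNormSq (η (q + v) κ) := by
    refine Finset.sum_congr rfl fun v _ => ?_
    simp only [dirGauge, nhsNormSq_Ad (hu _)]
  have hOscS : ∑ v ∈ B, ∑ μ : Fin d, nhsNormSq (dirGauge (lcomb κ M W z) η (q + v + e μ) κ - dirGauge (lcomb κ M W z) η (q + v) κ)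
      ≤ ∑ v ∈ B, ∑ μ : Fin d, (2 * nhsNormSq (covFd W η (q + v) μ κ) + 64 * α ^ 2 * nhsNormSq (η (q + v + e μ) κ)
          + 16 * α ^ 2 * nhsNormSq (η (q + v) κ)) :=
    Finset.sum_le_sum fun v hv => Finset.sum_le_sum fun μ _ => hOsc v hv μ
  have hSegS : ∑ v ∈ B, ∑ j ∈ range M,
        nhsNormSq (dirGauge (lcomb κ M W z) η (q + v + ((j : ℤ) + 1) • e κ) κ - dirGauge (lcomb κ M W z) η (q + v + (j : ℤ) • e κ) κ)
      ≤ ∑ v ∈ B, ∑ j ∈ range M, (2 * nhsNormSq (covFd W η (q + v + (j : ℤ) • e κ) κ κ)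
          + 64 * α ^ 2 * nhsNormSq (η (q + v + ((j : ℤ) + 1) • e κ) κ) + 16 * α ^ 2 * nhsNormSq (η (q + v + (j : ℤ) • e κ) κ)) :=
    Finset.sum_le_sum fun v hv => Finset.sum_le_sum fun j hj => hSeg v hv j hj
  rw [hLHS] at hcore
  have i1 := mul_le_mul_of_nonneg_left (mul_le_mul_of_nonneg_left hOscS (pow_nonneg hM0.le 2))
    (mul_nonneg (pow_nonneg hM0.le 2) (pow_nonneg hM0.le d))
  have i2 := mul_le_mul_of_nonneg_left hSegS (show (0 : ℝ) ≤ 4 * ((M : ℝ) ^ 2 * ((M : ℝ) ^ d * M)) by positivity)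
  linarith [hcore, i1, i2, hTsum]

/-! ## §5 THE CORE AT W ON THE TORUS -/

/-- **THE CORE AT W ON THE TORUS** (K4-d1; the curved twin of (71S) §1 with the line sums explicit; `W`, `η` `(M·N)`-periodic):
`M²·M^d·E ≤ M^d·M⁴·(10·CG + (80d + 448)·(dMa)²·E) + 8·TT` (letters as in the header, §5). [folklore] -/
theorem sum_nhsNormSq_le_covariant_torus {M N : ℕ} (hM : 1 ≤ M) (hN : 1 ≤ N) {W : Site d → Fin d → (Matrix n n ℂ)ˣ}
    (hW : IsUnitaryCfg W) (hWP : IsPeriodicCfg W ((M * N : ℕ) : ℤ)) {a : ℝ} (ha : 0 ≤ a) (hWa : SmallField W a)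
    (η : Site d → Fin d → Matrix n n ℂ) (hη : ∀ (x : Site d) (τ μ : Fin d), η (x + ((M * N : ℕ) : ℤ) • e τ) μ = η x μ) :
    (M : ℝ) ^ 2 * (M : ℝ) ^ d * ∑ x ∈ periodBox (d := d) (M * N), ∑ κ : Fin d, nhsNormSq (η x κ)
      ≤ (M : ℝ) ^ d * (M : ℝ) ^ 4
            * (10 * ∑ x ∈ periodBox (d := d) (M * N), ∑ μ : Fin d, ∑ ν : Fin d, nhsNormSq (covFd W η x μ ν)
              + (80 * d + 448) * ((d : ℝ) * M * a) ^ 2 * ∑ x ∈ periodBox (d := d) (M * N), ∑ κ : Fin d, nhsNormSq (η x κ))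
        + 8 * ∑ z ∈ periodBox (d := d) N, ∑ κ : Fin d, nhsNormSq (TWg M (combFrame W M) η z κ) := by
  have hMN : 1 ≤ M * N := Nat.one_le_iff_ne_zero.mpr (Nat.mul_ne_zero (by omega) (by omega))
  have hM0 : (0 : ℝ) < M := by exact_mod_cast (by omega : 0 < M)
  set B : Finset (Site d) := periodBox (d := d) M with hB
  set F : Finset (Site d) := periodBox (d := d) (M * N) with hF
  set E : ℝ := ∑ x ∈ F, ∑ κ : Fin d, nhsNormSq (η x κ) with hE
  set CG : ℝ := ∑ x ∈ F, ∑ μ : Fin d, ∑ ν : Fin d, nhsNormSq (covFd W η x μ ν) with hCG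
  have hstep : ∀ (q v : Site d) (κ : Fin d) (j : ℕ), q + v + (j : ℤ) • e κ + e κ = q + v + ((j : ℤ) + 1) • e κ :=
    fun q v κ j => by rw [add_smul, one_smul, add_assoc]
  -- periodicity of the summands
  have hηn : ∀ (κ : Fin d) (x : Site d) (τ : Fin d), nhsNormSq (η (x + ((M * N : ℕ) : ℤ) • e τ) κ) = nhsNormSq (η x κ) := by
    intro κ x τ; rw [hη]
  have hηn1 : ∀ (κ : Fin d) (x : Site d) (τ : Fin d),
      nhsNormSq (η (x + ((M * N : ℕ) : ℤ) • e τ + e κ) κ) = nhsNormSq (η (x + e κ) κ) := by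
    intro κ x τ; rw [add_right_comm x _ (e κ), hη]
  have hcovP : ∀ (κ : Fin d) (x : Site d) (τ : Fin d),
      nhsNormSq (covFd W η (x + ((M * N : ℕ) : ℤ) • e τ) κ κ) = nhsNormSq (covFd W η x κ κ) := by
    intro κ x τ
    simp only [covFd]
    rw [add_right_comm x _ (e κ), hWP, hWP, hη, hη]
  -- generic re-tilings: plain blocks, and `κ`-shifted blocks along `range M`
  have htile : ∀ G : Fin d → Site d → ℝ,
      ∑ z ∈ periodBox (d := d) N, ∑ κ : Fin d, ∑ v ∈ B, G κ ((M : ℤ) • z + v) = ∑ x ∈ F, ∑ κ : Fin d, G κ x := by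
    intro G
    rw [hF, ← sum_blocks_torus hM N (fun x => ∑ κ : Fin d, G κ x)]
    exact Finset.sum_congr rfl fun z _ => Finset.sum_comm
  have hshift : ∀ G : Fin d → Site d → ℝ, (∀ (κ : Fin d) (x : Site d) (τ : Fin d), G κ (x + ((M * N : ℕ) : ℤ) • e τ) = G κ x) →
      ∑ z ∈ periodBox (d := d) N, ∑ κ : Fin d, ∑ v ∈ B, ∑ j ∈ range M, G κ ((M : ℤ) • z + v + (j : ℤ) • e κ)
        = M * ∑ x ∈ F, ∑ κ : Fin d, G κ x := by
    intro G hG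
    calc ∑ z ∈ periodBox (d := d) N, ∑ κ : Fin d, ∑ v ∈ B, ∑ j ∈ range M, G κ ((M : ℤ) • z + v + (j : ℤ) • e κ)
        = ∑ κ : Fin d, ∑ j ∈ range M, ∑ z ∈ periodBox (d := d) N, ∑ v ∈ B, G κ ((M : ℤ) • z + v + (j : ℤ) • e κ) := by
          rw [Finset.sum_comm]
          refine Finset.sum_congr rfl fun κ _ => ?_
          exact sum_rotate3 (periodBox (d := d) N) B (range M) (fun z v j => G κ ((M : ℤ) • z + v + (j : ℤ) • e κ))
      _ = ∑ κ : Fin d, ∑ _j ∈ range M, ∑ x ∈ F, G κ x := by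
          refine Finset.sum_congr rfl fun κ _ => Finset.sum_congr rfl fun j _ => ?_
          exact sum_blocks_torus_shift hM hN (g := fun x => G κ x) (hG κ) _
      _ = M * ∑ x ∈ F, ∑ κ : Fin d, G κ x := by
          rw [Finset.sum_comm (s := F), Finset.mul_sum]
          refine Finset.sum_congr rfl fun κ _ => ?_
          rw [Finset.sum_const, card_range, nsmul_eq_mul]
  -- the summed terms one by one
  have hL : ∑ z ∈ periodBox (d := d) N, ∑ κ : Fin d, ∑ v ∈ B, nhsNormSq (η ((M : ℤ) • z + v) κ) = E :=
    htile (fun κ x => nhsNormSq (η x κ))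
  have hO1 : ∑ z ∈ periodBox (d := d) N, ∑ κ : Fin d, ∑ v ∈ B, ∑ μ : Fin d, nhsNormSq (covFd W η ((M : ℤ) • z + v) μ κ) = CG := by
    rw [htile (fun κ x => ∑ μ : Fin d, nhsNormSq (covFd W η x μ κ)), hCG]
    exact Finset.sum_congr rfl fun x _ => Finset.sum_comm
  have hO2 : ∑ z ∈ periodBox (d := d) N, ∑ κ : Fin d, ∑ v ∈ B, ∑ μ : Fin d, nhsNormSq (η ((M : ℤ) • z + v + e μ) κ) = d * E := by
    rw [htile (fun κ x => ∑ μ : Fin d, nhsNormSq (η (x + e μ) κ))]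
    calc ∑ x ∈ F, ∑ κ : Fin d, ∑ μ : Fin d, nhsNormSq (η (x + e μ) κ)
        = ∑ μ : Fin d, ∑ x ∈ F, ∑ κ : Fin d, nhsNormSq (η (x + e μ) κ) :=
          sum_rotate3 F univ univ (fun x κ μ => nhsNormSq (η (x + e μ) κ))
      _ = ∑ _μ : Fin d, E := by
          refine Finset.sum_congr rfl fun μ _ => ?_
          rw [hE, hF]
          exact sum_periodBox_shift (M * N) hMN (g := fun y => ∑ κ : Fin d, nhsNormSq (η y κ))
            (fun x τ => Finset.sum_congr rfl fun κ _ => hηn κ x τ) (e μ)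
      _ = d * E := by rw [Finset.sum_const, Finset.card_univ, Fintype.card_fin, nsmul_eq_mul]
  have hO3 : ∑ z ∈ periodBox (d := d) N, ∑ κ : Fin d, ∑ v ∈ B, ∑ _μ : Fin d, nhsNormSq (η ((M : ℤ) • z + v) κ) = d * E := by
    rw [htile (fun κ x => ∑ _μ : Fin d, nhsNormSq (η x κ)), hE, Finset.mul_sum]
    refine Finset.sum_congr rfl fun x _ => ?_
    rw [Finset.mul_sum]
    refine Finset.sum_congr rfl fun κ _ => ?_
    rw [Finset.sum_const, Finset.card_univ, Fintype.card_fin, nsmul_eq_mul]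
  have hS1 : ∑ z ∈ periodBox (d := d) N, ∑ κ : Fin d, ∑ v ∈ B, ∑ j ∈ range M,
      nhsNormSq (covFd W η ((M : ℤ) • z + v + (j : ℤ) • e κ) κ κ) ≤ M * CG := by
    rw [hshift (fun κ x => nhsNormSq (covFd W η x κ κ)) hcovP]
    refine mul_le_mul_of_nonneg_left ?_ (Nat.cast_nonneg M)
    rw [hCG]
    refine Finset.sum_le_sum fun x _ => Finset.sum_le_sum fun κ _ => ?_
    exact Finset.single_le_sum (f := fun ν => nhsNormSq (covFd W η x κ ν)) (fun _ _ => nhsNormSq_nonneg _) (Finset.mem_univ κ)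
  have hS2 : ∑ z ∈ periodBox (d := d) N, ∑ κ : Fin d, ∑ v ∈ B, ∑ j ∈ range M,
      nhsNormSq (η ((M : ℤ) • z + v + ((j : ℤ) + 1) • e κ) κ) = M * E := by
    have h := hshift (fun κ x => nhsNormSq (η (x + e κ) κ)) hηn1
    simp only [hstep] at h
    rw [h, hE, Finset.sum_comm (s := F)]
    congr 1
    rw [Finset.sum_comm (s := F) (t := (univ : Finset (Fin d)))]
    refine Finset.sum_congr rfl fun κ _ => ?_
    exact sum_periodBox_shift (M * N) hMN (g := fun y => nhsNormSq (η y κ)) (fun x τ => hηn κ x τ) (e κ)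
  have hS3 : ∑ z ∈ periodBox (d := d) N, ∑ κ : Fin d, ∑ v ∈ B, ∑ j ∈ range M,
      nhsNormSq (η ((M : ℤ) • z + v + (j : ℤ) • e κ) κ) = M * E :=
    hshift (fun κ x => nhsNormSq (η x κ)) hηn
  -- sum the local core over the blocks and the components
  have hloc := Finset.sum_le_sum fun z (_ : z ∈ periodBox (d := d) N) =>
    Finset.sum_le_sum fun κ (_ : κ ∈ (Finset.univ : Finset (Fin d))) => sum_block_nhsNormSq_le_covariant hM hW ha hWa η z κ
  simp only [Finset.sum_add_distrib, ← Finset.mul_sum] at hloc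
  rw [hL, hO1, hO2, hO3, hS2, hS3] at hloc
  have i2 := mul_le_mul_of_nonneg_left hS1 (show (0 : ℝ) ≤ 4 * ((M : ℝ) ^ 2 * ((M : ℝ) ^ d * M)) * 2 by positivity)
  have hfin : (M : ℝ) ^ 2 * (M : ℝ) ^ d * ((M : ℝ) ^ 2 * (2 * CG + 64 * ((d : ℝ) * M * a) ^ 2 * (d * E)
        + 16 * ((d : ℝ) * M * a) ^ 2 * (d * E)))
      + (4 * ((M : ℝ) ^ 2 * ((M : ℝ) ^ d * M)) * 2 * (M * CG)
        + 4 * ((M : ℝ) ^ 2 * ((M : ℝ) ^ d * M)) * (64 * ((d : ℝ) * M * a) ^ 2 * (M * E) + 16 * ((d : ℝ) * M * a) ^ 2 * (M * E)))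
      + 128 * ((M : ℝ) ^ d * (M : ℝ) ^ 3) * ((d : ℝ) * M * a) ^ 2 * (M * E)
      = (M : ℝ) ^ d * (M : ℝ) ^ 4 * (10 * CG + (80 * d + 448) * ((d : ℝ) * M * a) ^ 2 * E) := by ring
  linarith [hloc, i2, hfin]

/-- **THE Θ-FREE TWO-TERM FORM** (owner ruling ρ-g23-2: K6 substitutes K4-d2's S-identity for the middle term and never sees a Θ):
`Σ‖η‖²_HS ≤ 10·M²·CG + 8·(M²·M^d)⁻¹·TT + (80d + 448)·d²·(M²a)²·Σ‖η‖²_HS`. [folklore] -/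
theorem sum_nhsNormSq_le_covariant_torus' {M N : ℕ} (hM : 1 ≤ M) (hN : 1 ≤ N) {W : Site d → Fin d → (Matrix n n ℂ)ˣ}
    (hW : IsUnitaryCfg W) (hWP : IsPeriodicCfg W ((M * N : ℕ) : ℤ)) {a : ℝ} (ha : 0 ≤ a) (hWa : SmallField W a)
    (η : Site d → Fin d → Matrix n n ℂ) (hη : ∀ (x : Site d) (τ μ : Fin d), η (x + ((M * N : ℕ) : ℤ) • e τ) μ = η x μ) :
    ∑ x ∈ periodBox (d := d) (M * N), ∑ κ : Fin d, nhsNormSq (η x κ)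
      ≤ 10 * (M : ℝ) ^ 2 * ∑ x ∈ periodBox (d := d) (M * N), ∑ μ : Fin d, ∑ ν : Fin d, nhsNormSq (covFd W η x μ ν)
        + 8 * ((M : ℝ) ^ 2 * (M : ℝ) ^ d)⁻¹ * ∑ z ∈ periodBox (d := d) N, ∑ κ : Fin d, nhsNormSq (TWg M (combFrame W M) η z κ)
        + (80 * d + 448) * (d : ℝ) ^ 2 * ((M : ℝ) ^ 2 * a) ^ 2 * ∑ x ∈ periodBox (d := d) (M * N), ∑ κ : Fin d, nhsNormSq (η x κ) := by
  have h := sum_nhsNormSq_le_covariant_torus hM hN hW hWP ha hWa η hη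
  have hM0 : (0 : ℝ) < M := by exact_mod_cast (by omega : 0 < M)
  have hpos : (0 : ℝ) < (M : ℝ) ^ 2 * (M : ℝ) ^ d := by positivity
  refine le_of_mul_le_mul_left ?_ hpos
  have key : (M : ℝ) ^ 2 * (M : ℝ) ^ d * (8 * ((M : ℝ) ^ 2 * (M : ℝ) ^ d)⁻¹
      * ∑ z ∈ periodBox (d := d) N, ∑ κ : Fin d, nhsNormSq (TWg M (combFrame W M) η z κ))
      = 8 * ∑ z ∈ periodBox (d := d) N, ∑ κ : Fin d, nhsNormSq (TWg M (combFrame W M) η z κ) := by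
    field_simp
  have hfin : (M : ℝ) ^ d * (M : ℝ) ^ 4 * (10 * ∑ x ∈ periodBox (d := d) (M * N), ∑ μ : Fin d, ∑ ν : Fin d, nhsNormSq (covFd W η x μ ν)
        + (80 * d + 448) * ((d : ℝ) * M * a) ^ 2 * ∑ x ∈ periodBox (d := d) (M * N), ∑ κ : Fin d, nhsNormSq (η x κ))
      = (M : ℝ) ^ 2 * (M : ℝ) ^ d * (10 * (M : ℝ) ^ 2 * ∑ x ∈ periodBox (d := d) (M * N), ∑ μ : Fin d, ∑ ν : Fin d, nhsNormSq (covFd W η x μ ν))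
        + (M : ℝ) ^ 2 * (M : ℝ) ^ d * ((80 * d + 448) * (d : ℝ) ^ 2 * ((M : ℝ) ^ 2 * a) ^ 2
            * ∑ x ∈ periodBox (d := d) (M * N), ∑ κ : Fin d, nhsNormSq (η x κ)) := by ring
  rw [mul_add, mul_add, key]
  linarith [h, hfin]

/-- … and with K4-a's corner-read instance of record `TWc L k W η` at `M = L^k`:
`Σ‖η‖²_HS ≤ 10·(L^k)²·CG + 8·((L^k)²·(L^k)^d)⁻¹·Σ_zΣ_κ‖TWc L k W η z κ‖²_HS + (80d + 448)·d²·((L^k)²a)²·Σ‖η‖²_HS`. [folklore] -/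
theorem sum_nhsNormSq_le_covariant_torus_TWc {L k N : ℕ} (hL : 1 ≤ L) (hN : 1 ≤ N) {W : Site d → Fin d → (Matrix n n ℂ)ˣ}
    (hW : IsUnitaryCfg W) (hWP : IsPeriodicCfg W ((L ^ k * N : ℕ) : ℤ)) {a : ℝ} (ha : 0 ≤ a) (hWa : SmallField W a)
    (η : Site d → Fin d → Matrix n n ℂ) (hη : ∀ (x : Site d) (τ μ : Fin d), η (x + ((L ^ k * N : ℕ) : ℤ) • e τ) μ = η x μ) :
    ∑ x ∈ periodBox (d := d) (L ^ k * N), ∑ κ : Fin d, nhsNormSq (η x κ)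
      ≤ 10 * ((L ^ k : ℕ) : ℝ) ^ 2 * ∑ x ∈ periodBox (d := d) (L ^ k * N), ∑ μ : Fin d, ∑ ν : Fin d, nhsNormSq (covFd W η x μ ν)
        + 8 * (((L ^ k : ℕ) : ℝ) ^ 2 * ((L ^ k : ℕ) : ℝ) ^ d)⁻¹ * ∑ z ∈ periodBox (d := d) N, ∑ κ : Fin d, nhsNormSq (TWc L k W η z κ)
        + (80 * d + 448) * (d : ℝ) ^ 2 * (((L ^ k : ℕ) : ℝ) ^ 2 * a) ^ 2
            * ∑ x ∈ periodBox (d := d) (L ^ k * N), ∑ κ : Fin d, nhsNormSq (η x κ) :=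
  sum_nhsNormSq_le_covariant_torus' (Nat.one_le_pow _ _ hL) hN hW hWP ha hWa η hη

/-- **THE Θ-FORM OF SHAPE K4** (the literal curved analogue of (71S) §1): if the comb line sums of record obey
`Σ_zΣ_κ‖TWg M (combFrame W M) η z κ‖²_HS ≤ Θ·M^d·M⁴·CG`, then
`Σ_xΣ_κ‖η x κ‖²_HS ≤ (10 + 8Θ)·M²·CG + (80d + 448)·d²·(M²a)²·Σ_xΣ_κ‖η x κ‖²_HS` — the only remainder is `(M²a)² ×` the natural ℓ² size.
[folklore] -/
theorem sum_nhsNormSq_le_of_TWg_sq_le {M N : ℕ} (hM : 1 ≤ M) (hN : 1 ≤ N) {W : Site d → Fin d → (Matrix n n ℂ)ˣ}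
    (hW : IsUnitaryCfg W) (hWP : IsPeriodicCfg W ((M * N : ℕ) : ℤ)) {a : ℝ} (ha : 0 ≤ a) (hWa : SmallField W a)
    (η : Site d → Fin d → Matrix n n ℂ) (hη : ∀ (x : Site d) (τ μ : Fin d), η (x + ((M * N : ℕ) : ℤ) • e τ) μ = η x μ) {Θ : ℝ}
    (hT : ∑ z ∈ periodBox (d := d) N, ∑ κ : Fin d, nhsNormSq (TWg M (combFrame W M) η z κ)
      ≤ Θ * ((M : ℝ) ^ d * (M : ℝ) ^ 4) * ∑ x ∈ periodBox (d := d) (M * N), ∑ μ : Fin d, ∑ ν : Fin d, nhsNormSq (covFd W η x μ ν)) :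
    ∑ x ∈ periodBox (d := d) (M * N), ∑ κ : Fin d, nhsNormSq (η x κ)
      ≤ (10 + 8 * Θ) * (M : ℝ) ^ 2 * ∑ x ∈ periodBox (d := d) (M * N), ∑ μ : Fin d, ∑ ν : Fin d, nhsNormSq (covFd W η x μ ν)
        + (80 * d + 448) * (d : ℝ) ^ 2 * ((M : ℝ) ^ 2 * a) ^ 2
            * ∑ x ∈ periodBox (d := d) (M * N), ∑ κ : Fin d, nhsNormSq (η x κ) := by
  have hM0 : (0 : ℝ) < M := by exact_mod_cast (by omega : 0 < M)
  have h := sum_nhsNormSq_le_covariant_torus hM hN hW hWP ha hWa η hη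
  have hpos : (0 : ℝ) < (M : ℝ) ^ 2 * (M : ℝ) ^ d := by positivity
  refine le_of_mul_le_mul_left ?_ hpos
  have hfin : (M : ℝ) ^ d * (M : ℝ) ^ 4 * (10 * ∑ x ∈ periodBox (d := d) (M * N), ∑ μ : Fin d, ∑ ν : Fin d, nhsNormSq (covFd W η x μ ν)
        + (80 * d + 448) * ((d : ℝ) * M * a) ^ 2 * ∑ x ∈ periodBox (d := d) (M * N), ∑ κ : Fin d, nhsNormSq (η x κ))
      + 8 * (Θ * ((M : ℝ) ^ d * (M : ℝ) ^ 4) * ∑ x ∈ periodBox (d := d) (M * N), ∑ μ : Fin d, ∑ ν : Fin d, nhsNormSq (covFd W η x μ ν))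
      = (M : ℝ) ^ 2 * (M : ℝ) ^ d * ((10 + 8 * Θ) * (M : ℝ) ^ 2 * ∑ x ∈ periodBox (d := d) (M * N), ∑ μ : Fin d, ∑ ν : Fin d, nhsNormSq (covFd W η x μ ν)
        + (80 * d + 448) * (d : ℝ) ^ 2 * ((M : ℝ) ^ 2 * a) ^ 2
            * ∑ x ∈ periodBox (d := d) (M * N), ∑ κ : Fin d, nhsNormSq (η x κ)) := by ring
  linarith [h, hT, hfin]

end

end Summit.QuantumFields.BalabanUV.T4Continuum.NE3CovariantLineSumCore
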